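import Summits.AtomisticToContinuum.HydrodynamicLimit.Theorems.JParityClosureLocalSecondLawEquilibriumDefs
import Summits.AtomisticToContinuum.HydrodynamicLimit.Theorems.JParityClosureLocalSecondLawKineticStressStrain
import Summits.AtomisticToContinuum.HydrodynamicLimit.Theorems.JParityClosureLocalSecondLawCoarseFieldBounds
import Summits.AtomisticToContinuum.HydrodynamicLimit.Theorems.JParityClosureLocalSecondLawLedgerHonestB

/-!
# Equilibrium stub `eq_timeAverage`, part 1 (lead c3): joint measurability of the cut crux integrand

Equilibrium side-composition of line `exact-entropy-ledger-three-passivities` for the crux `JParityClosure.LocalSecondLaw`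
(stmt-AtomisticToContinuum-13081).  Inside the EOS band (`EosBand η₀ F`, `3σ³ < η₀`) the cut entropy density
`HsT = H(ρ_r, θ_r)·cutRho(ρ_r)` only reads the excess free energy below `3σ³`, where it coincides with the analytic band function
`F`; replacing `f_ex` by the Borel modification `F̃ = 𝟙_{(−η₀,η₀)}·F` gives a Borel function of `(ρ_r, θ_r)` (`HsT_eq_band`,
`measurable_bandDensity`).  With the joint measurability of the cone fields (`continuous_rhoC_uncurry`, `continuous_momC_uncurry`,
`psvK_measurable_thetaC_uncurry`) and the joint continuity of `∂ₛφ`, `∂ₖφ` for a smooth test function, the cut crux integrand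
`X̃(s, w, x)` and the deviation `|X̃ − X_det|` are jointly Borel in `(s, w, x)` (`measurable_Xtil`, `measurable_absDev`).

References: H. Spohn, *Large Scale Dynamics of Interacting Particles* (1991), Part I §2.3.
-/

noncomputable section

namespace Summit.AtomisticToContinuum.HydrodynamicLimit.Theorems.LocalSecondLawEquilibrium

open scoped BigOperators Topology Classical MeasureTheory ENNReal InnerProductSpace
open Filter Set MeasureTheory
open Literature.MathematicalPhysics.KineticTheory
open Literature.Analysis.FluidPDE
open Summit.AtomisticToContinuum.HydrodynamicLimit.Theorems.LocalSecondLawNegative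
open Summit.AtomisticToContinuum.HydrodynamicLimit.Theorems.LocalSecondLawLedger
open Summit.AtomisticToContinuum.HydrodynamicLimit.Theorems.LocalSecondLawLedger.L

namespace TimeAvg

variable {N : ℕ}

/-- The Borel modification `F̃ = 𝟙_{(−η₀, η₀)} F` of the band function is measurable (`F` is continuous on the band). -/
theorem measurable_bandPiecewise {η₀ : ℝ} {F : ℝ → ℝ} (hE : EosBand η₀ F) :
    Measurable ((Set.Ioo (-η₀) η₀).piecewise F 0) :=
  ContinuousOn.measurable_piecewise hE.2.1.continuousOn continuous_zero.continuousOn measurableSet_Ioo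

/-- **The band form of the cut entropy density.**  For `3σ³ < η₀`, for all `a, b`:
`Hs σ a b · cutRho a = (if 0 < a ∧ 0 < b then −a(3/2 log b − log a − F̃(aσ³)) else 0) · cutRho a`. -/
theorem Hs_mul_cutRho_eq_band {η₀ σ : ℝ} {F : ℝ → ℝ} (hE : EosBand η₀ F) (hσ : 0 < σ) (hσ3 : 3 * σ ^ 3 < η₀) (a b : ℝ) :
    Hs σ a b * cutRho a =
      (if 0 < a ∧ 0 < b then -(a * (3 / 2 * Real.log b - Real.log a - (Set.Ioo (-η₀) η₀).piecewise F 0 (a * σ ^ 3))) else 0) *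
        cutRho a := by
  by_cases ha3 : 3 ≤ a
  · rw [cutRho_eq_zero ha3, mul_zero, mul_zero]
  · push Not at ha3
    unfold Hs
    split_ifs with h
    · have hband : a * σ ^ 3 ∈ Set.Ioo (-η₀) η₀ := by
        constructor
        · have : 0 < a * σ ^ 3 := by have := h.1; positivity
          have : 0 < η₀ := hE.1
          linarith
        · calc a * σ ^ 3 < 3 * σ ^ 3 := by have := pow_pos hσ 3; nlinarith [h.1]
            _ < η₀ := hσ3
      have hIco : a * σ ^ 3 ∈ Set.Ico 0 η₀ := ⟨by have := h.1; positivity, hband.2⟩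
      rw [Set.piecewise_eq_of_mem _ _ _ hband, ← hE.2.2 hIco]
    · rfl

/-- The band density is a Borel function of `(a, b)`. -/
theorem measurable_bandDensity {η₀ σ : ℝ} {F : ℝ → ℝ} (hE : EosBand η₀ F) :
    Measurable fun p : ℝ × ℝ =>
      (if 0 < p.1 ∧ 0 < p.2 then -(p.1 * (3 / 2 * Real.log p.2 - Real.log p.1 -
        (Set.Ioo (-η₀) η₀).piecewise F 0 (p.1 * σ ^ 3))) else 0) * cutRho p.1 := by
  have hF := measurable_bandPiecewise hE
  have h1 : Measurable fun p : ℝ × ℝ => -(p.1 * (3 / 2 * Real.log p.2 - Real.log p.1 -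
      (Set.Ioo (-η₀) η₀).piecewise F 0 (p.1 * σ ^ 3))) :=
    (measurable_fst.mul (((Real.measurable_log.comp measurable_snd).const_mul _).sub
      (Real.measurable_log.comp measurable_fst) |>.sub (hF.comp (measurable_fst.mul_const _)))).neg
  have hset : MeasurableSet {p : ℝ × ℝ | 0 < p.1 ∧ 0 < p.2} :=
    (measurableSet_lt measurable_const measurable_fst).inter (measurableSet_lt measurable_const measurable_snd)
  exact (Measurable.ite hset h1 measurable_const).mul (continuous_cutRho.measurable.comp measurable_fst)

/-- **The cut entropy density is jointly Borel in (configuration, field point)** (inside the EOS band). -/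
theorem measurable_HsT_uncurry {η₀ σ : ℝ} {F : ℝ → ℝ} (hE : EosBand η₀ F) (hσ : 0 < σ) (hσ3 : 3 * σ ^ 3 < η₀) (r : ℝ) :
    Measurable fun q : Phase N × T3 => HsT σ r q.1 q.2 := by
  have hρ := (continuous_rhoC_uncurry (N := N) r).measurable
  have hθ := psvK_measurable_thetaC_uncurry (N := N) r
  have heq : (fun q : Phase N × T3 => HsT σ r q.1 q.2) = fun q =>
      (if 0 < rhoC r q.1 q.2 ∧ 0 < thetaC r q.1 q.2 then -(rhoC r q.1 q.2 * (3 / 2 * Real.log (thetaC r q.1 q.2) -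
        Real.log (rhoC r q.1 q.2) - (Set.Ioo (-η₀) η₀).piecewise F 0 (rhoC r q.1 q.2 * σ ^ 3))) else 0) *
        cutRho (rhoC r q.1 q.2) := by
    funext q; unfold HsT; exact Hs_mul_cutRho_eq_band hE hσ hσ3 _ _
  rw [heq]
  exact (measurable_bandDensity (σ := σ) hE).comp (hρ.prodMk hθ)

/-- **The cut crux integrand `X̃(s, w, x)` is jointly Borel in `(s, w, x)`** (EOS band, `0 < r`, smooth test function). -/
theorem measurable_Xtil {η₀ σ r : ℝ} {F : ℝ → ℝ} (hE : EosBand η₀ F) (hσ : 0 < σ) (hσ3 : 3 * σ ^ 3 < η₀) (hr : 0 < r)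
    {φ : ℝ → T3 → ℝ} (hφ : Literature.Analysis.FunctionSpaces.Torus.IsSmoothSpaceTimeOn Set.univ φ) :
    Measurable fun q : ℝ × Phase N × T3 => Xtil σ r φ q.1 q.2.1 q.2.2 := by
  have h1 : Measurable fun q : ℝ × Phase N × T3 => HsT σ r q.2.1 q.2.2 :=
    (measurable_HsT_uncurry (N := N) hE hσ hσ3 r).comp measurable_snd
  have h2 : Measurable fun q : ℝ × Phase N × T3 => deriv (fun s' => φ s' q.2.2) q.1 :=
    (continuous_uncurry_deriv_of_smooth hφ).measurable.comp (measurable_fst.prodMk (measurable_snd.comp measurable_snd))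
  have h3 : ∀ k, Measurable fun q : ℝ × Phase N × T3 => momC r q.2.1 q.2.2 k := fun k =>
    (continuous_momC₂ hr k).measurable.comp measurable_snd
  have h4 : Measurable fun q : ℝ × Phase N × T3 => rhoC r q.2.1 q.2.2 :=
    (continuous_rhoC_uncurry (N := N) r).measurable.comp measurable_snd
  have h5 : ∀ k, Measurable fun q : ℝ × Phase N × T3 => pD k (φ q.1) q.2.2 := fun k =>
    (continuous_uncurry_pD_phi hφ k).measurable.comp (measurable_fst.prodMk (measurable_snd.comp measurable_snd))
  unfold Xtil
  exact h1.mul (h2.add (Finset.measurable_sum _ fun k _ => ((h3 k).div h4).mul (h5 k)))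

/-- The deterministic integrand `X_det(s, x)` is jointly continuous, hence Borel, in `(s, x)`. -/
theorem measurable_Xdet (σ Θ : ℝ) (ū : V3) {φ : ℝ → T3 → ℝ}
    (hφ : Literature.Analysis.FunctionSpaces.Torus.IsSmoothSpaceTimeOn Set.univ φ) :
    Measurable fun q : ℝ × T3 => Xdet σ Θ ū φ q.1 q.2 := by
  have h2 : Measurable fun q : ℝ × T3 => deriv (fun s' => φ s' q.2) q.1 :=
    (continuous_uncurry_deriv_of_smooth hφ).measurable
  have h5 : ∀ k, Measurable fun q : ℝ × T3 => pD k (φ q.1) q.2 := fun k =>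
    (continuous_uncurry_pD_phi hφ k).measurable
  unfold Xdet
  exact measurable_const.mul (h2.add (Finset.measurable_sum _ fun k _ => (h5 k).const_mul _))

/-- **The deviation `|X̃ − X_det|` is jointly Borel in `(s, w, x)`.** -/
theorem measurable_absDev :
    ∀ {N : ℕ} {η₀ σ r Θ : ℝ} {F : ℝ → ℝ} (ū : V3), EosBand η₀ F → 0 < σ → 3 * σ ^ 3 < η₀ → 0 < r → ∀ {φ : ℝ → T3 → ℝ}, Literature.Analysis.FunctionSpaces.Torus.IsSmoothSpaceTimeOn Set.univ φ → Measurable fun q : ℝ × Phase N × T3 => ENNReal.ofReal |Xtil σ r φ q.1 q.2.1 q.2.2 - Xdet σ Θ ū φ q.1 q.2.2| := by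
  intro N η₀ σ r Θ F ū hE hσ hσ3 hr φ hφ
  have hX := measurable_Xtil (N := N) hE hσ hσ3 hr hφ
  have hD : Measurable fun q : ℝ × Phase N × T3 => Xdet σ Θ ū φ q.1 q.2.2 :=
    (measurable_Xdet σ Θ ū hφ).comp (measurable_fst.prodMk (measurable_snd.comp measurable_snd))
  exact ((hX.sub hD).abs).ennreal_ofReal

end TimeAvg

end Summit.AtomisticToContinuum.HydrodynamicLimit.Theorems.LocalSecondLawEquilibrium

end
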